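import Summits.BirchSwinnertonDyer.BirchSwinnertonDyer.Theorems.Rank2ObservatoryRank3SatCertT
import Summits.BirchSwinnertonDyer.BirchSwinnertonDyer.Theorems.Rank2ObservatoryRank3SatWitnessS
import HarnessLib

/-!
# BirchSwinnertonDyer — rank ≥ 2 observatory: rank-3 saturation certificates, torsion supplements

HONEST FRAMING: per-curve certified theorems and census instruments; no claim on BSD in rank ≥ 2.

Second half of the generic layer for the 30 torsion-supplement rows `satSkippedRows` (U/V/W) of
the rank-3 saturation census (first half: `Rank2ObservatoryRank3SatWitnessS` — torsion clauses
`twoTorsionPointB` / `notDoubleB` / `fourTorsionPointB` and shifted witnesses `tWitnessB/₂B/₃B`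
with the primes as data, and their soundness). Exactly as for the base instrument
(`Rank2ObservatoryListedSpan`: `listedSpan_two_saturated_of_not_mem_twoCoset`,
`linearIndependent_triple_of_not_mem_twoCoset`) the seven facts `ε·P ∉ 2E(ℚ) + E(ℚ)[2^u]` of a
rank certificate give `2`-SATURATION of the listed span `ℤP₁ + ℤP₂ + ℤP₃ + E(ℚ)_tors` and
`ℤ`-independence:

* the three certificates on an integral model `twoSaturated_of_certU` (torsion clause `T`, base
  witnesses `witnessB/₂B/₃B` at `u = 1`), `twoSaturated_of_certV` (torsion clause `T`, shifted
  witnesses w.r.t. `T` at `u = 1`), `twoSaturated_of_certW` (`t = 4m`, clause `T₄`, shifted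
  witnesses w.r.t. `T₄` at `u = 2`) — same conclusion as `twoSaturated_of_certB`;
* ONE row datum `Rank3SatCertS` (constructors `laneU`, `laneV`, `laneW` over the base
  certificate `Rank3SatCert`), the row Boolean `rank3SatCheckS` (kernel `decide`; shared base
  block `satBaseCheckB`), its soundness `Rank3Row.twoSaturated_of_satCheckS` (transport
  `Rank3Row.twoSaturated_of_scaled`) with the SAME conclusion as the base instrument, and the list
  form `rank3SatCheckSAll` / `Rank3Row.twoSaturated_of_satCheckSAll` — so the 30 residual rows can
  be tabulated (`Rank2ObservatoryRank3SatRowsS01.lean`) and the census made residual-free.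

Sorry-free; no `native_decide`; no instances, no notation.

References: Cremona, *Algorithms for Modular Elliptic Curves* (1997) §3.5; Siksek, Rocky Mountain
J. Math. 25 (1995); Silverman, *The Arithmetic of Elliptic Curves* (2009) III.2.3, VII.3.1(b),
VIII.6.7.
-/

-- single-conjunct summit: `Summit.BirchSwinnertonDyer.BirchSwinnertonDyer.…` repeats the name
set_option linter.dupNamespace false

open WeierstrassCurve

namespace Summit.BirchSwinnertonDyer.BirchSwinnertonDyer.Rank2Observatory

open Literature.NumberTheory.EllipticCurves

/-! ### The three certificates on an integral model -/

section Certificates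

variable (V : WeierstrassCurve ℤ) (hΔ : V.Δ ≠ 0) {X₁ Y₁ X₂ Y₂ X₃ Y₃ : ℤ}
  (e₁ : Y₁ ^ 2 + V.a₁ * X₁ * Y₁ + V.a₃ * Y₁ = X₁ ^ 3 + V.a₂ * X₁ ^ 2 + V.a₄ * X₁ + V.a₆)
  (e₂ : Y₂ ^ 2 + V.a₁ * X₂ * Y₂ + V.a₃ * Y₂ = X₂ ^ 3 + V.a₂ * X₂ ^ 2 + V.a₄ * X₂ + V.a₆)
  (e₃ : Y₃ ^ 2 + V.a₁ * X₃ * Y₃ + V.a₃ * Y₃ = X₃ ^ 3 + V.a₂ * X₃ ^ 2 + V.a₄ * X₃ + V.a₆)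

include hΔ e₁ e₂ e₃

open scoped Classical in
/-- **Lane U**: torsion annihilator `t = 2^e·m` from the counts with the clauses `twoTorsionPointB`,
`notDoubleB` (`2m · E(ℚ)_tors = 0`), and the base witnesses `witnessB/₂B/₃B` at `2`-exponent `1`;
conclusion as `twoSaturated_of_certB`. [cite: CremonaAlgorithms1997, §3.5]
[cite: SilvermanAEC2009, Prop. VII.3.1(b)] -/
theorem twoSaturated_of_certU {S : List (ℕ × ℕ)} {t e m : ℕ} (hm : m % 2 = 1)
    (hte : t = 2 ^ e * m) (hann : annihilatorCheck S t = true) (hS : S.all (killerB V) = true)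
    {xT yT : ℤ} {ℓ₁ ℓ₂ : ℕ} (hT : twoTorsionPointB V xT yT ℓ₁ = true)
    (hD : notDoubleB V xT ℓ₂ = true)
    {q₁ q₂ q₃ q₁₂ q₁₃ q₂₃ q₁₂₃ : ℕ} {X₁₂ Y₁₂ X₁₃ Y₁₃ X₂₃ Y₂₃ X₀ Y₀ X₁₂₃ Y₁₂₃ : ℤ}
    (hw₁ : witnessB V 1 q₁ X₁ Y₁ = true) (hw₂ : witnessB V 1 q₂ X₂ Y₂ = true)
    (hw₃ : witnessB V 1 q₃ X₃ Y₃ = true)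
    (hw₁₂ : witness₂B V 1 q₁₂ X₁ Y₁ X₂ Y₂ X₁₂ Y₁₂ = true)
    (hw₁₃ : witness₂B V 1 q₁₃ X₁ Y₁ X₃ Y₃ X₁₃ Y₁₃ = true)
    (hw₂₃ : witness₂B V 1 q₂₃ X₂ Y₂ X₃ Y₃ X₂₃ Y₂₃ = true)
    (hw₁₂₃ : witness₃B V 1 q₁₂₃ X₁ Y₁ X₂ Y₂ X₀ Y₀ X₃ Y₃ X₁₂₃ Y₁₂₃ = true) :
    (∀ a : (V.map (Int.castRingHom ℚ)).toAffine.Point,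
      2 • a ∈ AddSubgroup.closure
          {Affine.Point.some (X₁ : ℚ) (Y₁ : ℚ) (nonsingular_rat_of_eq V hΔ e₁),
            Affine.Point.some (X₂ : ℚ) (Y₂ : ℚ) (nonsingular_rat_of_eq V hΔ e₂),
            Affine.Point.some (X₃ : ℚ) (Y₃ : ℚ) (nonsingular_rat_of_eq V hΔ e₃)} ⊔
          AddCommGroup.torsion _ →
      a ∈ AddSubgroup.closure
          {Affine.Point.some (X₁ : ℚ) (Y₁ : ℚ) (nonsingular_rat_of_eq V hΔ e₁),
            Affine.Point.some (X₂ : ℚ) (Y₂ : ℚ) (nonsingular_rat_of_eq V hΔ e₂),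
            Affine.Point.some (X₃ : ℚ) (Y₃ : ℚ) (nonsingular_rat_of_eq V hΔ e₃)} ⊔
          AddCommGroup.torsion _) ∧
    LinearIndependent ℤ
      ![(Affine.Point.some (X₁ : ℚ) (Y₁ : ℚ) (nonsingular_rat_of_eq V hΔ e₁) :
          (V.map (Int.castRingHom ℚ)).toAffine.Point),
        Affine.Point.some (X₂ : ℚ) (Y₂ : ℚ) (nonsingular_rat_of_eq V hΔ e₂),
        Affine.Point.some (X₃ : ℚ) (Y₃ : ℚ) (nonsingular_rat_of_eq V hΔ e₃)] :=
  twoSaturated_of_certB' V hΔ e₁ e₂ e₃ hm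
    (torsion_zsmul_eq_zero_of_twoTorsionPointB V hte hann hS hT hD) hw₁ hw₂ hw₃ hw₁₂ hw₁₃ hw₂₃
    hw₁₂₃

open scoped Classical in
/-- **Lane V**: torsion as in lane U, and the seven SHIFTED witnesses `tWitnessB/₂B/₃B` w.r.t. the
rational `2`-torsion point `T` (`R̃, R̃ + T̃ ∉ 2Ẽ(𝔽_q)`), sound at `u = 1` because
`E(ℚ)[2] = {O, T}`; conclusion as `twoSaturated_of_certB`. [cite: CremonaAlgorithms1997, §3.5]
[cite: SilvermanAEC2009, Prop. VII.3.1(b)] -/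
theorem twoSaturated_of_certV {S : List (ℕ × ℕ)} {t e m : ℕ} (hm : m % 2 = 1)
    (hte : t = 2 ^ e * m) (hann : annihilatorCheck S t = true) (hS : S.all (killerB V) = true)
    {xT yT : ℤ} {ℓ₁ ℓ₂ : ℕ} (hT : twoTorsionPointB V xT yT ℓ₁ = true)
    (hD : notDoubleB V xT ℓ₂ = true)
    {q₁ q₂ q₃ q₁₂ q₁₃ q₂₃ q₁₂₃ : ℕ}
    {A₁ B₁ A₂ B₂ A₃ B₃ X₁₂ Y₁₂ A₁₂ B₁₂ X₁₃ Y₁₃ A₁₃ B₁₃ X₂₃ Y₂₃ A₂₃ B₂₃ : ℤ}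
    {X₀ Y₀ X₁₂₃ Y₁₂₃ A₁₂₃ B₁₂₃ : ℤ}
    (hw₁ : tWitnessB V xT yT q₁ X₁ Y₁ A₁ B₁ = true)
    (hw₂ : tWitnessB V xT yT q₂ X₂ Y₂ A₂ B₂ = true)
    (hw₃ : tWitnessB V xT yT q₃ X₃ Y₃ A₃ B₃ = true)
    (hw₁₂ : tWitness₂B V xT yT q₁₂ X₁ Y₁ X₂ Y₂ X₁₂ Y₁₂ A₁₂ B₁₂ = true)
    (hw₁₃ : tWitness₂B V xT yT q₁₃ X₁ Y₁ X₃ Y₃ X₁₃ Y₁₃ A₁₃ B₁₃ = true)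
    (hw₂₃ : tWitness₂B V xT yT q₂₃ X₂ Y₂ X₃ Y₃ X₂₃ Y₂₃ A₂₃ B₂₃ = true)
    (hw₁₂₃ : tWitness₃B V xT yT q₁₂₃ X₁ Y₁ X₂ Y₂ X₀ Y₀ X₃ Y₃ X₁₂₃ Y₁₂₃ A₁₂₃ B₁₂₃ = true) :
    (∀ a : (V.map (Int.castRingHom ℚ)).toAffine.Point,
      2 • a ∈ AddSubgroup.closure
          {Affine.Point.some (X₁ : ℚ) (Y₁ : ℚ) (nonsingular_rat_of_eq V hΔ e₁),
            Affine.Point.some (X₂ : ℚ) (Y₂ : ℚ) (nonsingular_rat_of_eq V hΔ e₂),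
            Affine.Point.some (X₃ : ℚ) (Y₃ : ℚ) (nonsingular_rat_of_eq V hΔ e₃)} ⊔
          AddCommGroup.torsion _ →
      a ∈ AddSubgroup.closure
          {Affine.Point.some (X₁ : ℚ) (Y₁ : ℚ) (nonsingular_rat_of_eq V hΔ e₁),
            Affine.Point.some (X₂ : ℚ) (Y₂ : ℚ) (nonsingular_rat_of_eq V hΔ e₂),
            Affine.Point.some (X₃ : ℚ) (Y₃ : ℚ) (nonsingular_rat_of_eq V hΔ e₃)} ⊔
          AddCommGroup.torsion _) ∧
    LinearIndependent ℤ
      ![(Affine.Point.some (X₁ : ℚ) (Y₁ : ℚ) (nonsingular_rat_of_eq V hΔ e₁) :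
          (V.map (Int.castRingHom ℚ)).toAffine.Point),
        Affine.Point.some (X₂ : ℚ) (Y₂ : ℚ) (nonsingular_rat_of_eq V hΔ e₂),
        Affine.Point.some (X₃ : ℚ) (Y₃ : ℚ) (nonsingular_rat_of_eq V hΔ e₃)] := by
  classical
  have hm' : Odd (m : ℤ) := by exact_mod_cast Nat.odd_iff.mpr hm
  have htors := torsion_zsmul_eq_zero_of_twoTorsionPointB V hte hann hS hT hD
  obtain ⟨hTe, h2⟩ := twoTorsion_of_twoTorsionPointB V hΔ hT
  have hL := tShiftLane_one V hTe h2
  have E₁ : V.toAffine.Equation X₁ Y₁ := (Affine.equation_iff X₁ Y₁).mpr e₁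
  have E₂ : V.toAffine.Equation X₂ Y₂ := (Affine.equation_iff X₂ Y₂).mpr e₂
  have E₃ : V.toAffine.Equation X₃ Y₃ := (Affine.equation_iff X₃ Y₃).mpr e₃
  have k₁ := not_mem_twoCoset_of_tWitnessB hL hw₁ E₁ (nonsingular_rat_of_eq V hΔ e₁)
  have k₂ := not_mem_twoCoset_of_tWitnessB hL hw₂ E₂ (nonsingular_rat_of_eq V hΔ e₂)
  have k₃ := not_mem_twoCoset_of_tWitnessB hL hw₃ E₃ (nonsingular_rat_of_eq V hΔ e₃)
  have k₁₂ := not_mem_twoCoset_of_tWitness₂B hL hw₁₂ E₁ E₂ (nonsingular_rat_of_eq V hΔ e₁)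
    (nonsingular_rat_of_eq V hΔ e₂)
  have k₁₃ := not_mem_twoCoset_of_tWitness₂B hL hw₁₃ E₁ E₃ (nonsingular_rat_of_eq V hΔ e₁)
    (nonsingular_rat_of_eq V hΔ e₃)
  have k₂₃ := not_mem_twoCoset_of_tWitness₂B hL hw₂₃ E₂ E₃ (nonsingular_rat_of_eq V hΔ e₂)
    (nonsingular_rat_of_eq V hΔ e₃)
  have k₁₂₃ := not_mem_twoCoset_of_tWitness₃B hL hw₁₂₃ E₁ E₂ E₃ (nonsingular_rat_of_eq V hΔ e₁)
    (nonsingular_rat_of_eq V hΔ e₂) (nonsingular_rat_of_eq V hΔ e₃)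
  exact ⟨listedSpan_two_saturated_of_not_mem_twoCoset hm' htors k₁ k₂ k₃ k₁₂ k₁₃ k₂₃ k₁₂₃,
    linearIndependent_triple_of_not_mem_twoCoset hm' htors k₁ k₂ k₃ k₁₂ k₁₃ k₂₃ k₁₂₃⟩

open scoped Classical in
/-- **Lane W**: torsion annihilator `t = 4m` (`m` odd) from the counts, the clause
`fourTorsionPointB` (`E(ℚ)[4] = {O, ±T₄, T}`), and the seven SHIFTED witnesses w.r.t. `T₄`, sound
at `u = 2`; conclusion as `twoSaturated_of_certB`. [cite: CremonaAlgorithms1997, §3.5]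
[cite: SilvermanAEC2009, Prop. VII.3.1(b)] -/
theorem twoSaturated_of_certW {S : List (ℕ × ℕ)} {t m : ℕ} (hm : m % 2 = 1)
    (htm : t = 2 ^ 2 * m) (hann : annihilatorCheck S t = true) (hS : S.all (killerB V) = true)
    {xT yT x₄ y₄ : ℤ} {ℓ₁ : ℕ} (h4 : fourTorsionPointB V xT yT x₄ y₄ ℓ₁ = true)
    {q₁ q₂ q₃ q₁₂ q₁₃ q₂₃ q₁₂₃ : ℕ}
    {A₁ B₁ A₂ B₂ A₃ B₃ X₁₂ Y₁₂ A₁₂ B₁₂ X₁₃ Y₁₃ A₁₃ B₁₃ X₂₃ Y₂₃ A₂₃ B₂₃ : ℤ}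
    {X₀ Y₀ X₁₂₃ Y₁₂₃ A₁₂₃ B₁₂₃ : ℤ}
    (hw₁ : tWitnessB V x₄ y₄ q₁ X₁ Y₁ A₁ B₁ = true)
    (hw₂ : tWitnessB V x₄ y₄ q₂ X₂ Y₂ A₂ B₂ = true)
    (hw₃ : tWitnessB V x₄ y₄ q₃ X₃ Y₃ A₃ B₃ = true)
    (hw₁₂ : tWitness₂B V x₄ y₄ q₁₂ X₁ Y₁ X₂ Y₂ X₁₂ Y₁₂ A₁₂ B₁₂ = true)
    (hw₁₃ : tWitness₂B V x₄ y₄ q₁₃ X₁ Y₁ X₃ Y₃ X₁₃ Y₁₃ A₁₃ B₁₃ = true)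
    (hw₂₃ : tWitness₂B V x₄ y₄ q₂₃ X₂ Y₂ X₃ Y₃ X₂₃ Y₂₃ A₂₃ B₂₃ = true)
    (hw₁₂₃ : tWitness₃B V x₄ y₄ q₁₂₃ X₁ Y₁ X₂ Y₂ X₀ Y₀ X₃ Y₃ X₁₂₃ Y₁₂₃ A₁₂₃ B₁₂₃ = true) :
    (∀ a : (V.map (Int.castRingHom ℚ)).toAffine.Point,
      2 • a ∈ AddSubgroup.closure
          {Affine.Point.some (X₁ : ℚ) (Y₁ : ℚ) (nonsingular_rat_of_eq V hΔ e₁),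
            Affine.Point.some (X₂ : ℚ) (Y₂ : ℚ) (nonsingular_rat_of_eq V hΔ e₂),
            Affine.Point.some (X₃ : ℚ) (Y₃ : ℚ) (nonsingular_rat_of_eq V hΔ e₃)} ⊔
          AddCommGroup.torsion _ →
      a ∈ AddSubgroup.closure
          {Affine.Point.some (X₁ : ℚ) (Y₁ : ℚ) (nonsingular_rat_of_eq V hΔ e₁),
            Affine.Point.some (X₂ : ℚ) (Y₂ : ℚ) (nonsingular_rat_of_eq V hΔ e₂),
            Affine.Point.some (X₃ : ℚ) (Y₃ : ℚ) (nonsingular_rat_of_eq V hΔ e₃)} ⊔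
          AddCommGroup.torsion _) ∧
    LinearIndependent ℤ
      ![(Affine.Point.some (X₁ : ℚ) (Y₁ : ℚ) (nonsingular_rat_of_eq V hΔ e₁) :
          (V.map (Int.castRingHom ℚ)).toAffine.Point),
        Affine.Point.some (X₂ : ℚ) (Y₂ : ℚ) (nonsingular_rat_of_eq V hΔ e₂),
        Affine.Point.some (X₃ : ℚ) (Y₃ : ℚ) (nonsingular_rat_of_eq V hΔ e₃)] := by
  classical
  have hm' : Odd (m : ℤ) := by exact_mod_cast Nat.odd_iff.mpr hm
  have htm' : (t : ℤ) = 2 ^ 2 * (m : ℤ) := by rw [htm]; push_cast; ring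
  have htors : ∀ x : (V.map (Int.castRingHom ℚ)).toAffine.Point, IsOfFinAddOrder x →
      ((2 : ℤ) ^ 2 * (m : ℤ)) • x = 0 :=
    fun x hx => zsmul_eq_zero_of_annihilatorCheck (killers_of_all_killerB V hS) hann htm' x hx
  obtain ⟨h₄e, h₄⟩ := fourTorsion_of_fourTorsionPointB V hΔ h4
  have hL := tShiftLane_two V hΔ h₄e h₄
  have E₁ : V.toAffine.Equation X₁ Y₁ := (Affine.equation_iff X₁ Y₁).mpr e₁
  have E₂ : V.toAffine.Equation X₂ Y₂ := (Affine.equation_iff X₂ Y₂).mpr e₂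
  have E₃ : V.toAffine.Equation X₃ Y₃ := (Affine.equation_iff X₃ Y₃).mpr e₃
  have k₁ := not_mem_twoCoset_of_tWitnessB hL hw₁ E₁ (nonsingular_rat_of_eq V hΔ e₁)
  have k₂ := not_mem_twoCoset_of_tWitnessB hL hw₂ E₂ (nonsingular_rat_of_eq V hΔ e₂)
  have k₃ := not_mem_twoCoset_of_tWitnessB hL hw₃ E₃ (nonsingular_rat_of_eq V hΔ e₃)
  have k₁₂ := not_mem_twoCoset_of_tWitness₂B hL hw₁₂ E₁ E₂ (nonsingular_rat_of_eq V hΔ e₁)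
    (nonsingular_rat_of_eq V hΔ e₂)
  have k₁₃ := not_mem_twoCoset_of_tWitness₂B hL hw₁₃ E₁ E₃ (nonsingular_rat_of_eq V hΔ e₁)
    (nonsingular_rat_of_eq V hΔ e₃)
  have k₂₃ := not_mem_twoCoset_of_tWitness₂B hL hw₂₃ E₂ E₃ (nonsingular_rat_of_eq V hΔ e₂)
    (nonsingular_rat_of_eq V hΔ e₃)
  have k₁₂₃ := not_mem_twoCoset_of_tWitness₃B hL hw₁₂₃ E₁ E₂ E₃ (nonsingular_rat_of_eq V hΔ e₁)
    (nonsingular_rat_of_eq V hΔ e₂) (nonsingular_rat_of_eq V hΔ e₃)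
  exact ⟨listedSpan_two_saturated_of_not_mem_twoCoset hm' htors k₁ k₂ k₃ k₁₂ k₁₃ k₂₃ k₁₂₃,
    linearIndependent_triple_of_not_mem_twoCoset hm' htors k₁ k₂ k₃ k₁₂ k₁₃ k₂₃ k₁₂₃⟩

end Certificates

/-! ### The row datum, the row Boolean and its soundness -/

/-- BASE BLOCK of the row Booleans (kernel `decide`), shared by the three lanes: with
`V = scaleModel r.intModel c.d` — `d ≠ 0`, `m` odd, `t = 2^e·m`; the scaled coordinates match the
row's projective generators; the three integral Weierstrass equations on `V`; `annihilatorCheck`;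
every kernel count passes `killerB V`. (The base field `c.u` is not read: the lane fixes the
`2`-exponent.) [cite: CremonaAlgorithms1997, §3.5] -/
def satBaseCheckB (r : Rank3Row) (c : Rank3SatCert) (e : ℕ) : Bool :=
  let V := scaleModel r.intModel c.d
  decide (c.d ≠ 0 ∧ c.m % 2 = 1 ∧ c.t = 2 ^ e * c.m ∧
      c.X₁ * r.P₁.2.2 = c.d ^ 2 * r.P₁.1 ∧ c.Y₁ * r.P₁.2.2 = c.d ^ 3 * r.P₁.2.1 ∧
      c.X₂ * r.P₂.2.2 = c.d ^ 2 * r.P₂.1 ∧ c.Y₂ * r.P₂.2.2 = c.d ^ 3 * r.P₂.2.1 ∧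
      c.X₃ * r.P₃.2.2 = c.d ^ 2 * r.P₃.1 ∧ c.Y₃ * r.P₃.2.2 = c.d ^ 3 * r.P₃.2.1 ∧
      c.Y₁ ^ 2 + V.a₁ * c.X₁ * c.Y₁ + V.a₃ * c.Y₁ =
        c.X₁ ^ 3 + V.a₂ * c.X₁ ^ 2 + V.a₄ * c.X₁ + V.a₆ ∧
      c.Y₂ ^ 2 + V.a₁ * c.X₂ * c.Y₂ + V.a₃ * c.Y₂ =
        c.X₂ ^ 3 + V.a₂ * c.X₂ ^ 2 + V.a₄ * c.X₂ + V.a₆ ∧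
      c.Y₃ ^ 2 + V.a₁ * c.X₃ * c.Y₃ + V.a₃ * c.Y₃ =
        c.X₃ ^ 3 + V.a₂ * c.X₃ ^ 2 + V.a₄ * c.X₃ + V.a₆) &&
  annihilatorCheck c.S c.t && c.S.all (killerB V)

/-- Certificate DATA for a torsion-supplement row: a base certificate `c` (scale, scaled points,
kernel counts, `t`, `m`, the seven witness primes and the chord residues; `c.u` unread) and, per
lane — `laneU`: the `2`-exponent `e` (`t = 2^e·m`), the rational `2`-torsion point `(x_T, y_T)` on
the scaled model and the primes `ℓ₁` (`twoTorsionPointB`), `ℓ₂` (`notDoubleB`); `laneV`: the same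
and the residues `(Aᵢ, Bᵢ) ≡ Rᵢ + T (mod qᵢ)` of the seven shifted tests; `laneW`: `(x_T, y_T)`,
the order-`4` point `(x₄, y₄)`, the prime `ℓ₁` (`fourTorsionPointB`) and the residues
`(Aᵢ, Bᵢ) ≡ Rᵢ + T₄ (mod qᵢ)`. Pure data; checked by `rank3SatCheckS`.
[cite: CremonaAlgorithms1997, §3.5] -/
inductive Rank3SatCertS where
  /-- lane U: base witnesses at `u = 1`, torsion exponent from a rational `2`-torsion point -/
  | laneU (c : Rank3SatCert) (e : ℕ) (xT yT : ℤ) (ℓ₁ ℓ₂ : ℕ)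
  /-- lane V: shifted witnesses w.r.t. `T` at `u = 1` -/
  | laneV (c : Rank3SatCert) (e : ℕ) (xT yT : ℤ) (ℓ₁ ℓ₂ : ℕ)
      (A₁ B₁ A₂ B₂ A₃ B₃ A₁₂ B₁₂ A₁₃ B₁₃ A₂₃ B₂₃ A₁₂₃ B₁₂₃ : ℤ)
  /-- lane W: shifted witnesses w.r.t. `T₄` at `u = 2`, `t = 4m` -/
  | laneW (c : Rank3SatCert) (xT yT x₄ y₄ : ℤ) (ℓ₁ : ℕ)
      (A₁ B₁ A₂ B₂ A₃ B₃ A₁₂ B₁₂ A₁₃ B₁₃ A₂₃ B₂₃ A₁₂₃ B₁₂₃ : ℤ)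

/-- **The row Boolean for the torsion supplements** (kernel `decide`): the base block
`satBaseCheckB`, the lane's torsion clause(s), and the lane's seven witnesses on
`V = scaleModel r.intModel c.d`. [cite: CremonaAlgorithms1997, §3.5] -/
def rank3SatCheckS (r : Rank3Row) : Rank3SatCertS → Bool
  | .laneU c e xT yT ℓ₁ ℓ₂ =>
      let V := scaleModel r.intModel c.d
      satBaseCheckB r c e && twoTorsionPointB V xT yT ℓ₁ && notDoubleB V xT ℓ₂ &&
      witnessB V 1 c.q₁ c.X₁ c.Y₁ && witnessB V 1 c.q₂ c.X₂ c.Y₂ && witnessB V 1 c.q₃ c.X₃ c.Y₃ &&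
      witness₂B V 1 c.q₁₂ c.X₁ c.Y₁ c.X₂ c.Y₂ c.X₁₂ c.Y₁₂ &&
      witness₂B V 1 c.q₁₃ c.X₁ c.Y₁ c.X₃ c.Y₃ c.X₁₃ c.Y₁₃ &&
      witness₂B V 1 c.q₂₃ c.X₂ c.Y₂ c.X₃ c.Y₃ c.X₂₃ c.Y₂₃ &&
      witness₃B V 1 c.q₁₂₃ c.X₁ c.Y₁ c.X₂ c.Y₂ c.X₀ c.Y₀ c.X₃ c.Y₃ c.X₁₂₃ c.Y₁₂₃
  | .laneV c e xT yT ℓ₁ ℓ₂ A₁ B₁ A₂ B₂ A₃ B₃ A₁₂ B₁₂ A₁₃ B₁₃ A₂₃ B₂₃ A₁₂₃ B₁₂₃ =>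
      let V := scaleModel r.intModel c.d
      satBaseCheckB r c e && twoTorsionPointB V xT yT ℓ₁ && notDoubleB V xT ℓ₂ &&
      tWitnessB V xT yT c.q₁ c.X₁ c.Y₁ A₁ B₁ && tWitnessB V xT yT c.q₂ c.X₂ c.Y₂ A₂ B₂ &&
      tWitnessB V xT yT c.q₃ c.X₃ c.Y₃ A₃ B₃ &&
      tWitness₂B V xT yT c.q₁₂ c.X₁ c.Y₁ c.X₂ c.Y₂ c.X₁₂ c.Y₁₂ A₁₂ B₁₂ &&
      tWitness₂B V xT yT c.q₁₃ c.X₁ c.Y₁ c.X₃ c.Y₃ c.X₁₃ c.Y₁₃ A₁₃ B₁₃ &&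
      tWitness₂B V xT yT c.q₂₃ c.X₂ c.Y₂ c.X₃ c.Y₃ c.X₂₃ c.Y₂₃ A₂₃ B₂₃ &&
      tWitness₃B V xT yT c.q₁₂₃ c.X₁ c.Y₁ c.X₂ c.Y₂ c.X₀ c.Y₀ c.X₃ c.Y₃ c.X₁₂₃ c.Y₁₂₃ A₁₂₃ B₁₂₃
  | .laneW c xT yT x₄ y₄ ℓ₁ A₁ B₁ A₂ B₂ A₃ B₃ A₁₂ B₁₂ A₁₃ B₁₃ A₂₃ B₂₃ A₁₂₃ B₁₂₃ =>
      let V := scaleModel r.intModel c.d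
      satBaseCheckB r c 2 && fourTorsionPointB V xT yT x₄ y₄ ℓ₁ &&
      tWitnessB V x₄ y₄ c.q₁ c.X₁ c.Y₁ A₁ B₁ && tWitnessB V x₄ y₄ c.q₂ c.X₂ c.Y₂ A₂ B₂ &&
      tWitnessB V x₄ y₄ c.q₃ c.X₃ c.Y₃ A₃ B₃ &&
      tWitness₂B V x₄ y₄ c.q₁₂ c.X₁ c.Y₁ c.X₂ c.Y₂ c.X₁₂ c.Y₁₂ A₁₂ B₁₂ &&
      tWitness₂B V x₄ y₄ c.q₁₃ c.X₁ c.Y₁ c.X₃ c.Y₃ c.X₁₃ c.Y₁₃ A₁₃ B₁₃ &&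
      tWitness₂B V x₄ y₄ c.q₂₃ c.X₂ c.Y₂ c.X₃ c.Y₃ c.X₂₃ c.Y₂₃ A₂₃ B₂₃ &&
      tWitness₃B V x₄ y₄ c.q₁₂₃ c.X₁ c.Y₁ c.X₂ c.Y₂ c.X₀ c.Y₀ c.X₃ c.Y₃ c.X₁₂₃ c.Y₁₂₃ A₁₂₃ B₁₂₃

/-- **SOUNDNESS of the row certificate, torsion supplements**: same conclusion as
`Rank3Row.twoSaturated_of_satCheck` — the listed generators are `ℤ`-independent and span, with
`E(ℚ)_tors`, a `2`-saturated subgroup of `E(ℚ) = r.curve⟮ℚ⟯` (lane certificate on the scaled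
model, transport `Rank3Row.twoSaturated_of_scaled`). [cite: CremonaAlgorithms1997, §3.5]
[cite: SilvermanAEC2009, III.3.1(b)] -/
theorem Rank3Row.twoSaturated_of_satCheckS (r : Rank3Row) (h : r.check = true) :
    ∀ w : Rank3SatCertS, rank3SatCheckS r w = true →
      (∀ a : r.curve.toAffine.Point,
        2 • a ∈ AddSubgroup.closure {r.gen₁ h, r.gen₂ h, r.gen₃ h} ⊔ AddCommGroup.torsion _ →
          a ∈ AddSubgroup.closure {r.gen₁ h, r.gen₂ h, r.gen₃ h} ⊔ AddCommGroup.torsion _) ∧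
      LinearIndependent ℤ ![r.gen₁ h, r.gen₂ h, r.gen₃ h]
  | .laneU c e xT yT ℓ₁ ℓ₂, hc => by
    simp only [rank3SatCheckS, satBaseCheckB, Bool.and_eq_true, decide_eq_true_eq] at hc
    obtain ⟨⟨⟨⟨⟨⟨⟨⟨⟨⟨⟨⟨hd, hm, hte, hX₁, hY₁, hX₂, hY₂, hX₃, hY₃, e₁, e₂, e₃⟩, hann⟩, hS⟩, hT⟩,
      hD⟩, hw₁⟩, hw₂⟩, hw₃⟩, hw₁₂⟩, hw₁₃⟩, hw₂₃⟩, hw₁₂₃⟩ := hc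
    have hΔ : (scaleModel r.intModel c.d).Δ ≠ 0 := Δ_ne_zero_of_witnessB hw₁
    exact r.twoSaturated_of_scaled h hd hX₁ hY₁ hX₂ hY₂ hX₃ hY₃ hΔ e₁ e₂ e₃
      (twoSaturated_of_certU _ hΔ e₁ e₂ e₃ hm hte hann hS hT hD hw₁ hw₂ hw₃ hw₁₂ hw₁₃ hw₂₃ hw₁₂₃)
  | .laneV c e xT yT ℓ₁ ℓ₂ A₁ B₁ A₂ B₂ A₃ B₃ A₁₂ B₁₂ A₁₃ B₁₃ A₂₃ B₂₃ A₁₂₃ B₁₂₃, hc => by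
    simp only [rank3SatCheckS, satBaseCheckB, Bool.and_eq_true, decide_eq_true_eq] at hc
    obtain ⟨⟨⟨⟨⟨⟨⟨⟨⟨⟨⟨⟨hd, hm, hte, hX₁, hY₁, hX₂, hY₂, hX₃, hY₃, e₁, e₂, e₃⟩, hann⟩, hS⟩, hT⟩,
      hD⟩, hw₁⟩, hw₂⟩, hw₃⟩, hw₁₂⟩, hw₁₃⟩, hw₂₃⟩, hw₁₂₃⟩ := hc
    have hΔ : (scaleModel r.intModel c.d).Δ ≠ 0 := Δ_ne_zero_of_tWitnessB hw₁
    exact r.twoSaturated_of_scaled h hd hX₁ hY₁ hX₂ hY₂ hX₃ hY₃ hΔ e₁ e₂ e₃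
      (twoSaturated_of_certV _ hΔ e₁ e₂ e₃ hm hte hann hS hT hD hw₁ hw₂ hw₃ hw₁₂ hw₁₃ hw₂₃ hw₁₂₃)
  | .laneW c xT yT x₄ y₄ ℓ₁ A₁ B₁ A₂ B₂ A₃ B₃ A₁₂ B₁₂ A₁₃ B₁₃ A₂₃ B₂₃ A₁₂₃ B₁₂₃, hc => by
    simp only [rank3SatCheckS, satBaseCheckB, Bool.and_eq_true, decide_eq_true_eq] at hc
    obtain ⟨⟨⟨⟨⟨⟨⟨⟨⟨⟨⟨hd, hm, htm, hX₁, hY₁, hX₂, hY₂, hX₃, hY₃, e₁, e₂, e₃⟩, hann⟩, hS⟩, h4⟩,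
      hw₁⟩, hw₂⟩, hw₃⟩, hw₁₂⟩, hw₁₃⟩, hw₂₃⟩, hw₁₂₃⟩ := hc
    have hΔ : (scaleModel r.intModel c.d).Δ ≠ 0 := Δ_ne_zero_of_tWitnessB hw₁
    exact r.twoSaturated_of_scaled h hd hX₁ hY₁ hX₂ hY₂ hX₃ hY₃ hΔ e₁ e₂ e₃
      (twoSaturated_of_certW _ hΔ e₁ e₂ e₃ hm htm hann hS h4 hw₁ hw₂ hw₃ hw₁₂ hw₁₃ hw₂₃ hw₁₂₃)

/-- The torsion-supplement Boolean over a list of rows and certificates (same order). [folklore] -/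
def rank3SatCheckSAll : List Rank3Row → List Rank3SatCertS → Bool
  | [], _ => true
  | _ :: _, [] => false
  | r :: rs, w :: ws => rank3SatCheckS r w && rank3SatCheckSAll rs ws

/-- **Soundness of the list form, torsion supplements.** [cite: CremonaAlgorithms1997, §3.5] -/
theorem Rank3Row.twoSaturated_of_satCheckSAll :
    ∀ {rows : List Rank3Row} {ws : List Rank3SatCertS}, rank3SatCheckSAll rows ws = true →
      ∀ r ∈ rows, ∀ h : r.check = true,
        (∀ a : r.curve.toAffine.Point,
          2 • a ∈ AddSubgroup.closure {r.gen₁ h, r.gen₂ h, r.gen₃ h} ⊔ AddCommGroup.torsion _ →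
            a ∈ AddSubgroup.closure {r.gen₁ h, r.gen₂ h, r.gen₃ h} ⊔ AddCommGroup.torsion _) ∧
        LinearIndependent ℤ ![r.gen₁ h, r.gen₂ h, r.gen₃ h]
  | [], _, _ => by simp
  | _ :: _, [], h => by simp [rank3SatCheckSAll] at h
  | r :: rs, w :: ws, h => by
    rw [rank3SatCheckSAll, Bool.and_eq_true] at h
    intro r' hr' h'
    rcases List.mem_cons.mp hr' with rfl | hr'
    · exact r'.twoSaturated_of_satCheckS h' w h.1
    · exact Rank3Row.twoSaturated_of_satCheckSAll h.2 r' hr' h'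

end Summit.BirchSwinnertonDyer.BirchSwinnertonDyer.Rank2Observatory
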